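import Mathlib
import HarnessLib
import Literature.MathematicalPhysics.KineticTheory.LangevinChainGibbs
import Summits.AtomisticToContinuum.FouriersLaw.Theorems.JunctionLocalityInsertionPackage

/-!
# Insertion identity toolbox, IX: current conservation, Cauchy–Schwarz at the junction, the insertion identity (core form)

Support file for stub `stub_insertionIdentity` (line `thermalise-then-cut-probe-insertion`, crux
`stmt-AtomisticToContinuum-11748`). Current conservation in the plain chain's first-order NESS
(test the weak equation against the energy `H`; `∫ H W dμ_T = 0` by the `p_0 ↔ p_{L−1}` symmetry),
the bath-power pairing through a forward field, Cauchy–Schwarz at the junction, and the INSERTION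
IDENTITY in core form: from `h ∈ L²` solving the weak equation and representing `G` through the
bath-1 power, symmetric Onsager data, the two end forward fields and their Kubo rows, the two squared
floating identities `(𝒢₁(θ) − G)² ≤ γ⁴ ‖S_K gb₁‖² v_K(h − θe_K)`, `(𝒢₄(θ) − G)² ≤ γ⁴ ‖S_K gb₄‖² v_K(h − θe_K)`
(the sum rule `∑_b ⟨gb₁, p_b² − T⟩ = T²/γ` is the consistency of the diagonal Kubo row with the
off-diagonal ones). Vocabulary of the skeleton written out; the stub file unfolds its frames into
this theorem. All [folklore]. No definitions.

IMPORT DISCIPLINE. This toolbox serves a stub file that must restate the skeleton's vocabulary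
(`kin`, `thermo`, `junctionOU`, `deviceGenerator`, `condK`, …) verbatim inside the skeleton's
namespace; therefore it imports no `Theorems/` file whose closure declares any of those names (e.g.
`…ThermoIBP.lean`, hence none of `…KuboCutoff/KuboDirichlet/…Aux*.lean`), and overlaps with such
files are re-derived here rather than imported.
-/

noncomputable section

open scoped ContDiff Topology ENNReal NNReal Convolution Pointwise
open MeasureTheory ProbabilityTheory Filter Set Function
open Literature.MathematicalPhysics.KineticTheory.HeatConduction

namespace Summit.AtomisticToContinuum.FouriersLaw.Cruxes.SuperadditiveResistance.InsertionToolbox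

local notation "uP" i' => ((0, Pi.single i' 1) : PhaseSpace _)
local notation "uQ" i' => ((Pi.single i' 1, 0) : PhaseSpace _)

local notation "OU⟦" T' ";" i' ";" f' ";" x' "⟧" =>
  T' * partialP i' (partialP i' f') x' - Prod.snd (x' : PhaseSpace _) i' * partialP i' f' x'
local notation "XH⟦" P' ";" f' ";" x' "⟧" =>
  ∑ i, (Prod.snd (x' : PhaseSpace _) i * partialQ i f' x' -
    partialQ i (OscillatorChain.hamiltonian P' _) x' * partialP i f' x')
local notation "GEN⟦" P' ";" T' ";" c' ";" f' ";" x' "⟧" =>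
  XH⟦P' ; f' ; x'⟧ + ∑ i, c' i * OU⟦T' ; i ; f' ; x'⟧
local notation "CUT⟦" ω₂' ";" lam' ";" β' ";" γ' ";" n' ";" x' "⟧" =>
  Real.smoothTransition (2 - OscillatorChain.hamiltonian (pinnedChain ω₂' lam' β' γ') _ x' / ((n' : ℝ) + 1))

namespace Assembly

local notation "SC⟦" T' ";" c' ";" f' ";" x' "⟧" => ∑ i, c' i * OU⟦T' ; i ; f' ; x'⟧
set_option quotPrecheck false in
local notation "KIN⟦" L' ";" s' ";" x' "⟧" =>
  (∑ i : Fin L', if i.val = s' then Prod.snd (x' : PhaseSpace L') i ^ 2 else 0)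
set_option quotPrecheck false in
local notation "THERMO⟦" L' ";" s' ";" θ' ";" f' ";" x' "⟧" =>
  (∑ i : Fin L', if i.val = s' then θ' * partialP i (partialP i f') x' -
    Prod.snd (x' : PhaseSpace L') i * partialP i f' x' else 0)
set_option quotPrecheck false in
local notation "JOU⟦" T' ";" N' ";" M' ";" f' ";" x' "⟧" =>
  (THERMO⟦N' + M' ; N' - 1 ; T' ; f' ; x'⟧ + THERMO⟦N' + M' ; N' ; T' ; f' ; x'⟧)
set_option quotPrecheck false in
local notation "EK⟦" T' ";" N' ";" M' ";" x' "⟧" =>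
  ((KIN⟦N' + M' ; N' - 1 ; x'⟧ + KIN⟦N' + M' ; N' ; x'⟧) / (2 * T' ^ 2))
set_option quotPrecheck false in
local notation "CONDK⟦" T' ";" N' ";" M' ";" f' ";" x' "⟧" =>
  (∫ ξ : Fin (N' + M') → ℝ, f' (Prod.fst (x' : PhaseSpace (N' + M')),
    fun i => if i.val = N' - 1 ∨ i.val = N' then ξ i else Prod.snd (x' : PhaseSpace (N' + M')) i)
    ∂(Measure.pi fun _ : Fin (N' + M') => gaussianReal 0 (Real.toNNReal T')))
set_option quotPrecheck false in
local notation "PSRC⟦" P' ";" T' ";" L' ";" x' "⟧" =>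
  (OscillatorChain.γ P' / (2 * T' ^ 2) * (KIN⟦L' ; 0 ; x'⟧ - KIN⟦L' ; L' - 1 ; x'⟧))

variable {L : ℕ}

/-! ### Current conservation: `⟨p_0² − T, h⟩ = −⟨p_{L−1}² − T, h⟩` -/

section Current

variable {ω₂ lam β : ℝ}

set_option hygiene false in
local notation "Pch" => pinnedChain ω₂ lam β γ
set_option hygiene false in
local notation "μ♭" => OscillatorChain.gibbsMeasure (pinnedChain ω₂ lam β γ) L T
set_option hygiene false in
local notation "c0L" => (fun i : Fin L =>
  (pinnedChain ω₂ lam β γ).γ * ((if i.val = 0 then 1 else 0) + (if i.val = L - 1 then 1 else 0)))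

/-- `𝓛_T H = γ(T − p_0²) + γ(T − p_{L−1}²)` for the plain chain (`L ≥ 1`). [folklore] -/
theorem gen_plain_hamiltonian (γ : ℝ) {L : ℕ} (hL : 1 ≤ L) (T : ℝ) (x : PhaseSpace L) :
    GEN⟦Pch ; T ; c0L ; (Pch).hamiltonian L ; x⟧ =
      (Pch).γ * (T - KIN⟦L ; 0 ; x⟧) + (Pch).γ * (T - KIN⟦L ; L - 1 ; x⟧) := by
  rw [gen_hamiltonian, kin_eq_sq (show 0 < L by omega), kin_eq_sq (show L - 1 < L by omega)]
  have e0 : ∀ i : Fin L, (i.val = 0) ↔ ((⟨0, by omega⟩ : Fin L) = i) := fun i =>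
    ⟨fun h => Fin.ext h.symm, fun h => (congrArg Fin.val h).symm⟩
  have e1 : ∀ i : Fin L, (i.val = L - 1) ↔ ((⟨L - 1, by omega⟩ : Fin L) = i) := fun i =>
    ⟨fun h => Fin.ext h.symm, fun h => (congrArg Fin.val h).symm⟩
  simp only [e0, e1, mul_add, add_mul, Finset.sum_add_distrib]
  have r1 : ∀ i : Fin L, ((Pch).γ * (if (⟨0, by omega⟩ : Fin L) = i then 1 else 0)) * (T - x.2 i ^ 2) =
      if (⟨0, by omega⟩ : Fin L) = i then (Pch).γ * (T - x.2 i ^ 2) else 0 := fun i => by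
    split_ifs <;> ring
  have r2 : ∀ i : Fin L, ((Pch).γ * (if (⟨L - 1, by omega⟩ : Fin L) = i then 1 else 0)) * (T - x.2 i ^ 2) =
      if (⟨L - 1, by omega⟩ : Fin L) = i then (Pch).γ * (T - x.2 i ^ 2) else 0 := fun i => by
    split_ifs <;> ring
  rw [Finset.sum_congr rfl fun i _ => r1 i, Finset.sum_congr rfl fun i _ => r2 i,
    Finset.sum_ite_eq, Finset.sum_ite_eq]
  simp

/-- **Current conservation in the plain chain's first-order NESS**: the linearised powers of the
two end baths balance, `∫ (p_0² − T) h dμ_T = −∫ (p_{L−1}² − T) h dμ_T` (test the weak equation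
against the energy `H`; `∫ H W dμ_T = 0` by the `p_0 ↔ p_{L−1}` symmetry of `μ_T`). [folklore] -/
theorem current_conservation (hω : 0 < ω₂) (hl : 0 ≤ lam) (hβ : 0 ≤ β) {γ : ℝ} (hγ : 0 < γ)
    {L : ℕ} (hL : 1 ≤ L) {T : ℝ} (hT : 0 < T) {h : PhaseSpace L → ℝ} (hh : MemLp h 2 μ♭)
    (hweak : ∀ f : PhaseSpace L → ℝ, ContDiff ℝ ∞ f → HasCompactSupport f →
      ∫ x, (Pch).generator L T T f x * h x ∂μ♭ = -∫ x, f x * PSRC⟦Pch ; T ; L ; x⟧ ∂μ♭) :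
    ∫ x, (KIN⟦L ; 0 ; x⟧ - T) * h x ∂μ♭ = -∫ x, (KIN⟦L ; L - 1 ; x⟧ - T) * h x ∂μ♭ := by
  have hPγ : (Pch).γ = γ := rfl
  have hHs : ContDiff ℝ ∞ ((Pch).hamiltonian L) := pinnedChain_contDiff_hamiltonian ω₂ lam β γ L
  have hH0 := pinnedChain_hamiltonian_nonneg hω.le hl hβ γ L
  -- `H`, `𝓛_T H`, `∂_{p_i} H` are in `L²(μ_T)`
  have hHL2 : MemLp ((Pch).hamiltonian L) 2 μ♭ :=
    pinnedChain_memLp_two_of_abs_le hω hl hβ γ L hT (pinnedChain_continuous_hamiltonian ω₂ lam β γ L)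
      (C := 1) (k := 1) fun x => by rw [abs_of_nonneg (hH0 x), pow_one]; linarith [hH0 x]
  have hGH : ∀ x, GEN⟦Pch ; T ; c0L ; (Pch).hamiltonian L ; x⟧ =
      (Pch).γ * (T - KIN⟦L ; 0 ; x⟧) + (Pch).γ * (T - KIN⟦L ; L - 1 ; x⟧) := gen_plain_hamiltonian γ hL T
  have hGHL2 : MemLp (fun x : PhaseSpace L => GEN⟦Pch ; T ; c0L ; (Pch).hamiltonian L ; x⟧) 2 μ♭ := by
    have e : (fun x : PhaseSpace L => GEN⟦Pch ; T ; c0L ; (Pch).hamiltonian L ; x⟧) = fun x =>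
        (-(Pch).γ) * ((KIN⟦L ; 0 ; x⟧ - T) + (KIN⟦L ; L - 1 ; x⟧ - T)) := by
      funext x; rw [hGH]; ring
    rw [e]
    exact ((memLp_kin_sub hω hl hβ γ L hT 0 T).add (memLp_kin_sub hω hl hβ γ L hT (L - 1) T)).const_mul _
  have hdH : ∀ i : Fin L, c0L i ≠ 0 → MemLp (partialP i ((Pch).hamiltonian L)) 2 μ♭ := by
    intro i _
    have e : partialP i ((Pch).hamiltonian L) = fun x => x.2 i := funext fun x =>
      (Pch).partialP_hamiltonian L x i
    rw [e]
    refine pinnedChain_memLp_two_of_abs_le hω hl hβ γ L hT (continuous_snd_apply_phaseSpace i)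
      (C := 1) (k := 1) fun x => ?_
    have h1 := abs_le_half_add_sq_half (x.2 i)
    have h2 := pinnedChain_sq_le_hamiltonian hω.le hl hβ γ L x i
    rw [pow_one]; linarith
  have hW : MemLp (fun x : PhaseSpace L => PSRC⟦Pch ; T ; L ; x⟧) 2 μ♭ := by
    have e : (fun x : PhaseSpace L => PSRC⟦Pch ; T ; L ; x⟧) = fun x => (Pch).γ / (2 * T ^ 2) *
        ((KIN⟦L ; 0 ; x⟧ - T) - (KIN⟦L ; L - 1 ; x⟧ - T)) := by
      funext x; ring
    rw [e]
    exact ((memLp_kin_sub hω hl hβ γ L hT 0 T).sub (memLp_kin_sub hω hl hβ γ L hT (L - 1) T)).const_mul _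
  have hweak' : ∀ φ : PhaseSpace L → ℝ, ContDiff ℝ ((⊤ : ℕ∞) : WithTop ℕ∞) φ → HasCompactSupport φ →
      ∫ x, GEN⟦Pch ; T ; c0L ; φ ; x⟧ * h x ∂μ♭ = -∫ x, φ x * PSRC⟦Pch ; T ; L ; x⟧ ∂μ♭ := by
    intro φ hφ hφc
    rw [← hweak φ hφ hφc]
    exact integral_congr_ae (ae_of_all _ fun x => by simp only [generator_eq_weighted])
  have key := pinnedChain_weak_pairing hω hl hβ γ L T _ (m := ⊤) le_top hh
    (W := fun x : PhaseSpace L => PSRC⟦Pch ; T ; L ; x⟧) hW hweak' hHs hHL2 hGHL2 hdH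
  -- the right-hand side vanishes by the `p_0 ↔ p_{L-1}` symmetry
  have hHW : ∫ x, (Pch).hamiltonian L x * PSRC⟦Pch ; T ; L ; x⟧ ∂μ♭ = 0 := by
    have hint : ∀ s : ℕ, s < L → Integrable (fun x : PhaseSpace L =>
        (Pch).hamiltonian L x * KIN⟦L ; s ; x⟧) μ♭ := by
      intro s hs
      refine pinnedChain_integrable_of_abs_le hω hl hβ γ L hT
        ((pinnedChain_continuous_hamiltonian ω₂ lam β γ L).mul (contDiff_kin s (n := 0)).continuous)
        (C := 2) (k := 2) fun x => ?_
      have hk := kin_le_two_mul_hamiltonian hω.le hl hβ γ s x (L := L)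
      rw [abs_of_nonneg (mul_nonneg (hH0 x) hk.1)]
      nlinarith [hH0 x, hk.1, hk.2]
    have e : (fun x : PhaseSpace L => (Pch).hamiltonian L x * PSRC⟦Pch ; T ; L ; x⟧) =
        fun x => (Pch).γ / (2 * T ^ 2) * ((Pch).hamiltonian L x * KIN⟦L ; 0 ; x⟧ -
          (Pch).hamiltonian L x * KIN⟦L ; L - 1 ; x⟧) := by
      funext x; ring
    rw [e, integral_const_mul, integral_sub (hint 0 (by omega)) (hint (L - 1) (by omega))]
    have hsym : ∫ x, (Pch).hamiltonian L x * KIN⟦L ; 0 ; x⟧ ∂μ♭ = ∫ x, (Pch).hamiltonian L x * KIN⟦L ; L - 1 ; x⟧ ∂μ♭ := by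
      simp only [kin_eq_sq (show 0 < L by omega), kin_eq_sq (show L - 1 < L by omega)]
      exact integral_hamiltonian_mul_sq_eq Pch L T ⟨0, by omega⟩ ⟨L - 1, by omega⟩
    rw [hsym, sub_self, mul_zero]
  rw [hHW, neg_zero] at key
  -- unfold `𝓛_T H` on the left
  have hint2 : ∀ s : ℕ, Integrable (fun x : PhaseSpace L => (KIN⟦L ; s ; x⟧ - T) * h x) μ♭ := fun s =>
    (memLp_kin_sub hω hl hβ γ L hT s T).integrable_mul hh
  have e2 : (fun x : PhaseSpace L => GEN⟦Pch ; T ; c0L ; (Pch).hamiltonian L ; x⟧ * h x) =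
      fun x => (-(Pch).γ) * ((KIN⟦L ; 0 ; x⟧ - T) * h x) + (-(Pch).γ) * ((KIN⟦L ; L - 1 ; x⟧ - T) * h x) := by
    funext x; rw [hGH]; ring
  rw [e2, integral_add ((hint2 0).const_mul _) ((hint2 (L - 1)).const_mul _), integral_const_mul,
    integral_const_mul, hPγ] at key
  have hγ0 : γ ≠ 0 := hγ.ne'
  have := mul_left_cancel₀ (neg_ne_zero.mpr hγ0) (show (-γ) * (∫ x, (KIN⟦L ; 0 ; x⟧ - T) * h x ∂μ♭) =
    (-γ) * (-∫ x, (KIN⟦L ; L - 1 ; x⟧ - T) * h x ∂μ♭) by linarith)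
  exact this

end Current

/-! ### The insertion identity (core form, vocabulary written out) -/

section Core

variable {ω₂ lam β : ℝ}

set_option hygiene false in
local notation "Pch" => pinnedChain ω₂ lam β γ
set_option hygiene false in
local notation "μ♭" => OscillatorChain.gibbsMeasure (pinnedChain ω₂ lam β γ) (N + M) T

/-- One end of the insertion identity: the bath-power pairing of `h` through a forward field `gb`
of the terminal observable `p_s² − T`:
`∫ (p_s² − T) h = (γ/2T²)(∫ gb (p_0² − T) − ∫ gb (p_{L−1}² − T)) − γ ∫ (S_K gb) h`. [folklore] -/
theorem bathPower_pairing (hω : 0 < ω₂) (hl : 0 ≤ lam) (hβ : 0 ≤ β) (γ : ℝ)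
    {T : ℝ} (hT : 0 < T) {N M s : ℕ} {gb h : PhaseSpace (N + M) → ℝ}
    (hL2 : MemLp gb 2 μ♭) (hSL2 : MemLp (fun x : PhaseSpace (N + M) => JOU⟦T ; N ; M ; gb ; x⟧) 2 μ♭)
    (hdev : ∀ x : PhaseSpace (N + M),
      (Pch).generator (N + M) T T gb x + (Pch).γ * JOU⟦T ; N ; M ; gb ; x⟧ = -(KIN⟦N + M ; s ; x⟧ - T))
    (hh : MemLp h 2 μ♭)
    (hP1 : ∫ x, (Pch).generator (N + M) T T gb x * h x ∂μ♭ = -∫ x, gb x * PSRC⟦Pch ; T ; N + M ; x⟧ ∂μ♭) :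
    ∫ x, (KIN⟦N + M ; s ; x⟧ - T) * h x ∂μ♭ =
      γ / (2 * T ^ 2) * ((∫ x, gb x * (KIN⟦N + M ; 0 ; x⟧ - T) ∂μ♭) -
        ∫ x, gb x * (KIN⟦N + M ; N + M - 1 ; x⟧ - T) ∂μ♭) -
      γ * ∫ x, JOU⟦T ; N ; M ; gb ; x⟧ * h x ∂μ♭ := by
  have hPγ : (Pch).γ = γ := rfl
  have hdev' : ∀ x, (Pch).generator (N + M) T T gb x =
      -(KIN⟦N + M ; s ; x⟧ - T) - γ * JOU⟦T ; N ; M ; gb ; x⟧ := fun x => by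
    have := hdev x; rw [hPγ] at this; linarith
  have hSh : Integrable (fun x => JOU⟦T ; N ; M ; gb ; x⟧ * h x) μ♭ := hSL2.integrable_mul hh
  have hKh : Integrable (fun x => -((KIN⟦N + M ; s ; x⟧ - T) * h x)) μ♭ :=
    ((memLp_kin_sub hω hl hβ γ (N + M) hT s T).integrable_mul hh).neg
  have hSh' : Integrable (fun x => γ * (JOU⟦T ; N ; M ; gb ; x⟧ * h x)) μ♭ := hSh.const_mul γ
  have e1 : ∫ x, (Pch).generator (N + M) T T gb x * h x ∂μ♭ =
      -(∫ x, (KIN⟦N + M ; s ; x⟧ - T) * h x ∂μ♭) - γ * ∫ x, JOU⟦T ; N ; M ; gb ; x⟧ * h x ∂μ♭ := by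
    rw [← integral_neg, ← integral_const_mul, ← integral_sub hKh hSh']
    exact integral_congr_ae (ae_of_all _ fun x => by simp only [hdev']; ring)
  have hgk : ∀ t : ℕ, Integrable (fun x => gb x * (KIN⟦N + M ; t ; x⟧ - T)) μ♭ := fun t =>
    hL2.integrable_mul (memLp_kin_sub hω hl hβ γ (N + M) hT t T)
  have e2 : ∫ x, gb x * PSRC⟦Pch ; T ; N + M ; x⟧ ∂μ♭ =
      γ / (2 * T ^ 2) * ((∫ x, gb x * (KIN⟦N + M ; 0 ; x⟧ - T) ∂μ♭) -
        ∫ x, gb x * (KIN⟦N + M ; N + M - 1 ; x⟧ - T) ∂μ♭) := by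
    rw [← integral_sub (hgk 0) (hgk (N + M - 1)), ← integral_const_mul]
    exact integral_congr_ae (ae_of_all _ fun x => by rw [hPγ]; ring)
  rw [e1, e2] at hP1
  linarith

/-- **The insertion identity, core form.** From: `h ∈ L²(μ_T)` solving the plain chain's weak
equation on `C^∞_c` and representing `G` through the bath-1 power; the symmetric Onsager data `g`;
the two forward fields of the end baths (as `C²` solutions in `L²` with `S_K gb ∈ L²`) and their
Kubo rows — the two squared floating identities
`(𝒢₁(θ) − G)² ≤ γ⁴ ‖S_K gb₁‖² ‖(I−Π_K)(h − θe_K)‖²`, `(𝒢₄(θ) − G)² ≤ γ⁴ ‖S_K gb₄‖² ‖(I−Π_K)(h − θe_K)‖²`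
(all vocabulary of the line's skeleton written out). [folklore] -/
theorem insertion_core (hω : 0 < ω₂) (hlam : 0 < lam) (hβ : 0 < β) {γ : ℝ} (hγ : 0 < γ) {T : ℝ}
    (hT : 0 < T) {N M : ℕ} (hN : 2 ≤ N) (hM : 2 ≤ M) (h : PhaseSpace (N + M) → ℝ) (G : ℝ)
    (g : Fin 4 → Fin 4 → ℝ) (gb₁ gb₄ : PhaseSpace (N + M) → ℝ) (θ : ℝ)
    (hhL2 : MemLp h 2 μ♭)
    (hweak : ∀ f : PhaseSpace (N + M) → ℝ, ContDiff ℝ ∞ f → HasCompactSupport f →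
      ∫ x, (Pch).generator (N + M) T T f x * h x ∂μ♭ = -∫ x, f x * PSRC⟦Pch ; T ; N + M ; x⟧ ∂μ♭)
    (hG : G = (Pch).γ * (1 / 2 - ∫ x, (KIN⟦N + M ; 0 ; x⟧ - T) * h x ∂μ♭))
    (hsym : ∀ a b, g a b = g b a)
    (h1C2 : ContDiff ℝ 2 gb₁) (h1L2 : MemLp gb₁ 2 μ♭)
    (h1SL2 : MemLp (fun x : PhaseSpace (N + M) => JOU⟦T ; N ; M ; gb₁ ; x⟧) 2 μ♭)
    (h1dev : ∀ x : PhaseSpace (N + M),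
      (Pch).generator (N + M) T T gb₁ x + (Pch).γ * JOU⟦T ; N ; M ; gb₁ ; x⟧ = -(KIN⟦N + M ; 0 ; x⟧ - T))
    (h4C2 : ContDiff ℝ 2 gb₄) (h4L2 : MemLp gb₄ 2 μ♭)
    (h4SL2 : MemLp (fun x : PhaseSpace (N + M) => JOU⟦T ; N ; M ; gb₄ ; x⟧) 2 μ♭)
    (h4dev : ∀ x : PhaseSpace (N + M),
      (Pch).generator (N + M) T T gb₄ x + (Pch).γ * JOU⟦T ; N ; M ; gb₄ ; x⟧ =
        -(KIN⟦N + M ; N + M - 1 ; x⟧ - T))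
    (hg01 : g 0 1 = (Pch).γ ^ 2 / T ^ 2 * ∫ x, gb₁ x * (KIN⟦N + M ; N - 1 ; x⟧ - T) ∂μ♭)
    (hg02 : g 0 2 = (Pch).γ ^ 2 / T ^ 2 * ∫ x, gb₁ x * (KIN⟦N + M ; N ; x⟧ - T) ∂μ♭)
    (hg03 : g 0 3 = (Pch).γ ^ 2 / T ^ 2 * ∫ x, gb₁ x * (KIN⟦N + M ; N + M - 1 ; x⟧ - T) ∂μ♭)
    (hself1 : g 0 1 + g 0 2 + g 0 3 =
      (Pch).γ - (Pch).γ ^ 2 / T ^ 2 * ∫ x, gb₁ x * (KIN⟦N + M ; 0 ; x⟧ - T) ∂μ♭)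
    (hg30 : g 3 0 = (Pch).γ ^ 2 / T ^ 2 * ∫ x, gb₄ x * (KIN⟦N + M ; 0 ; x⟧ - T) ∂μ♭)
    (hg31 : g 3 1 = (Pch).γ ^ 2 / T ^ 2 * ∫ x, gb₄ x * (KIN⟦N + M ; N - 1 ; x⟧ - T) ∂μ♭)
    (hg32 : g 3 2 = (Pch).γ ^ 2 / T ^ 2 * ∫ x, gb₄ x * (KIN⟦N + M ; N ; x⟧ - T) ∂μ♭)
    (hself4 : g 0 3 + g 1 3 + g 2 3 =
      (Pch).γ - (Pch).γ ^ 2 / T ^ 2 * ∫ x, gb₄ x * (KIN⟦N + M ; N + M - 1 ; x⟧ - T) ∂μ♭) :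
    (g 0 3 + (g 0 1 + g 0 2) * (1 / 2 - θ) - G) ^ 2 ≤
      γ ^ 4 * (∫ x, JOU⟦T ; N ; M ; gb₁ ; x⟧ ^ 2 ∂μ♭) *
        ∫ x, ((h x - θ * EK⟦T ; N ; M ; x⟧) -
          CONDK⟦T ; N ; M ; fun y : PhaseSpace (N + M) => h y - θ * EK⟦T ; N ; M ; y⟧ ; x⟧) ^ 2 ∂μ♭ ∧
    (g 0 3 + (g 1 3 + g 2 3) * (1 / 2 + θ) - G) ^ 2 ≤
      γ ^ 4 * (∫ x, JOU⟦T ; N ; M ; gb₄ ; x⟧ ^ 2 ∂μ♭) *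
        ∫ x, ((h x - θ * EK⟦T ; N ; M ; x⟧) -
          CONDK⟦T ; N ; M ; fun y : PhaseSpace (N + M) => h y - θ * EK⟦T ; N ; M ; y⟧ ; x⟧) ^ 2 ∂μ♭ := by
  have hl : 0 ≤ lam := hlam.le
  have hb : 0 ≤ β := hβ.le
  have hN1 : 1 ≤ N := by omega
  have hM1 : 1 ≤ M := by omega
  have hPγ : (Pch).γ = γ := rfl
  haveI := pinnedChain_isProbabilityMeasure_gibbsMeasure hω hl hb γ (N + M) hT
  -- the plain source is in `L²`
  have hW : MemLp (fun x : PhaseSpace (N + M) => PSRC⟦Pch ; T ; N + M ; x⟧) 2 μ♭ := by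
    have e : (fun x : PhaseSpace (N + M) => PSRC⟦Pch ; T ; N + M ; x⟧) = fun x => (Pch).γ / (2 * T ^ 2) *
        ((KIN⟦N + M ; 0 ; x⟧ - T) - (KIN⟦N + M ; N + M - 1 ; x⟧ - T)) := by
      funext x; ring
    rw [e]
    exact ((memLp_kin_sub hω hl hb γ (N + M) hT 0 T).sub
      (memLp_kin_sub hω hl hb γ (N + M) hT (N + M - 1) T)).const_mul _
  -- the weak equation on `C²_c` (mollification)
  have hweak2 := weak_tests_two_of_smooth (Pch) (pinnedChain_contDiff_U ω₂ lam β γ)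
    (pinnedChain_contDiff_V ω₂ lam β γ) (N + M) T μ♭ (hhL2.integrable one_le_two)
    (W := fun x : PhaseSpace (N + M) => PSRC⟦Pch ; T ; N + M ; x⟧) (hW.integrable one_le_two) hweak
  -- the analytic packages of the two forward fields
  obtain ⟨hP1₁, hP2₁, hP3₁⟩ :=
    forwardField_pairings hω hl hb hγ hT hN1 hM1 h1C2 h1L2 h1SL2 h1dev hhL2 hweak2
  obtain ⟨hP1₄, hP2₄, hP3₄⟩ :=
    forwardField_pairings hω hl hb hγ hT hN1 hM1 h4C2 h4L2 h4SL2 h4dev hhL2 hweak2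
  -- current conservation and the bath-power pairings
  have hcur := current_conservation hω hl hb hγ (L := N + M) (by omega) hT hhL2 hweak
  have hK1 := bathPower_pairing hω hl hb γ hT h1L2 h1SL2 h1dev hhL2 hP1₁
  have hK4 := bathPower_pairing hω hl hb γ hT h4L2 h4SL2 h4dev hhL2 hP1₄
  -- `⟨S_K gb, e_K⟩ = -(J_a + J_b)/T²`
  have hJ : ∀ {gb : PhaseSpace (N + M) → ℝ}, MemLp gb 2 μ♭ →
      ∫ x, gb x * ((2 * T - KIN⟦N + M ; N - 1 ; x⟧ - KIN⟦N + M ; N ; x⟧) / T ^ 2) ∂μ♭ =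
        -(1 / T ^ 2) * ((∫ x, gb x * (KIN⟦N + M ; N - 1 ; x⟧ - T) ∂μ♭) +
          ∫ x, gb x * (KIN⟦N + M ; N ; x⟧ - T) ∂μ♭) := by
    intro gb hgbL2
    have i1 : Integrable (fun x => gb x * (KIN⟦N + M ; N - 1 ; x⟧ - T)) μ♭ :=
      hgbL2.integrable_mul (memLp_kin_sub hω hl hb γ (N + M) hT (N - 1) T)
    have i2 : Integrable (fun x => gb x * (KIN⟦N + M ; N ; x⟧ - T)) μ♭ :=
      hgbL2.integrable_mul (memLp_kin_sub hω hl hb γ (N + M) hT N T)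
    rw [← integral_add i1 i2, ← integral_const_mul]
    exact integral_congr_ae (ae_of_all _ fun x => by field_simp; ring)
  have hIe1 := hP2₁.trans (hJ h1L2)
  have hIe4 := hP2₄.trans (hJ h4L2)
  simp only [hPγ] at hg01 hg02 hg03 hg30 hg31 hg32 hself1 hself4 hG
  -- the two floating identities
  have hid1 : g 0 3 + (g 0 1 + g 0 2) * (1 / 2 - θ) - G =
      -γ ^ 2 * ((∫ x, JOU⟦T ; N ; M ; gb₁ ; x⟧ * h x ∂μ♭) -
        θ * ∫ x, JOU⟦T ; N ; M ; gb₁ ; x⟧ * EK⟦T ; N ; M ; x⟧ ∂μ♭) := by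
    rw [hG, hK1, hIe1, hg01, hg02, hg03]
    rw [hg01, hg02, hg03] at hself1
    linear_combination (1 / 2 : ℝ) * hself1
  have hid4 : g 0 3 + (g 1 3 + g 2 3) * (1 / 2 + θ) - G =
      γ ^ 2 * ((∫ x, JOU⟦T ; N ; M ; gb₄ ; x⟧ * h x ∂μ♭) -
        θ * ∫ x, JOU⟦T ; N ; M ; gb₄ ; x⟧ * EK⟦T ; N ; M ; x⟧ ∂μ♭) := by
    rw [hsym 0 3, hsym 1 3, hsym 2 3] at hself4 ⊢
    rw [hG, hcur, hK4, hIe4, hg30, hg31, hg32]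
    rw [hg30, hg31, hg32] at hself4
    linear_combination (1 / 2 : ℝ) * hself4
  -- Cauchy–Schwarz at the junction
  have hcs1 := junction_cs hω hl hb γ N M hT h1SL2 hhL2 θ hP3₁
  have hcs4 := junction_cs hω hl hb γ N M hT h4SL2 hhL2 θ hP3₄
  have hγ4 : 0 ≤ γ ^ 4 := by positivity
  constructor
  · rw [hid1, mul_assoc]
    calc (-γ ^ 2 * ((∫ x, JOU⟦T ; N ; M ; gb₁ ; x⟧ * h x ∂μ♭) -
          θ * ∫ x, JOU⟦T ; N ; M ; gb₁ ; x⟧ * EK⟦T ; N ; M ; x⟧ ∂μ♭)) ^ 2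
        = γ ^ 4 * ((∫ x, JOU⟦T ; N ; M ; gb₁ ; x⟧ * h x ∂μ♭) -
          θ * ∫ x, JOU⟦T ; N ; M ; gb₁ ; x⟧ * EK⟦T ; N ; M ; x⟧ ∂μ♭) ^ 2 := by ring
      _ ≤ _ := mul_le_mul_of_nonneg_left hcs1 hγ4
  · rw [hid4, mul_assoc]
    calc (γ ^ 2 * ((∫ x, JOU⟦T ; N ; M ; gb₄ ; x⟧ * h x ∂μ♭) -
          θ * ∫ x, JOU⟦T ; N ; M ; gb₄ ; x⟧ * EK⟦T ; N ; M ; x⟧ ∂μ♭)) ^ 2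
        = γ ^ 4 * ((∫ x, JOU⟦T ; N ; M ; gb₄ ; x⟧ * h x ∂μ♭) -
          θ * ∫ x, JOU⟦T ; N ; M ; gb₄ ; x⟧ * EK⟦T ; N ; M ; x⟧ ∂μ♭) ^ 2 := by ring
      _ ≤ _ := mul_le_mul_of_nonneg_left hcs4 hγ4

end Core

end Assembly

/-- Registered helper stub of this support file: current conservation in the plain chain's first-order steady state, `∫ (p_0² − T) h dμ_T = −∫ (p_{L−1}² − T) h dμ_T`. [folklore] -/
theorem helper_insertionCore : ∀ {ω₂ lam β : ℝ}, 0 < ω₂ → 0 ≤ lam → 0 ≤ β → ∀ {γ : ℝ}, 0 < γ → ∀ {L : ℕ}, 1 ≤ L → ∀ {T : ℝ}, 0 < T → ∀ {h : PhaseSpace L → ℝ}, MemLp h 2 ((pinnedChain ω₂ lam β γ).gibbsMeasure L T) → (∀ f : PhaseSpace L → ℝ, ContDiff ℝ ∞ f → HasCompactSupport f → ∫ x, (pinnedChain ω₂ lam β γ).generator L T T f x * h x ∂((pinnedChain ω₂ lam β γ).gibbsMeasure L T) = -∫ x, f x * ((pinnedChain ω₂ lam β γ).γ / (2 * T ^ 2)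 * ((∑ i : Fin L, if i.val = 0 then x.2 i ^ 2 else 0) - (∑ i : Fin L, if i.val = L - 1 then x.2 i ^ 2 else 0))) ∂((pinnedChain ω₂ lam β γ).gibbsMeasure L T)) → ∫ x, ((∑ i : Fin L, if i.val = 0 then x.2 i ^ 2 else 0) - T) * h x ∂((pinnedChain ω₂ lam β γ).gibbsMeasure L T) = -∫ x, ((∑ i : Fin L, if i.val = L - 1 then x.2 i ^ 2 else 0) - T) * h x ∂((pinnedChain ω₂ lam β γ).gibbsMeasure L T) := by
  intro ω₂ lam β hω hl hβ γ hγ L hL T hT h hh hweak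
  exact Assembly.current_conservation hω hl hβ hγ hL hT hh hweak

end Summit.AtomisticToContinuum.FouriersLaw.Cruxes.SuperadditiveResistance.InsertionToolbox

end
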